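import Summits.QuantumFields.YangMills.Theorems.BalabanUVNodesN15TwoSpacingGluingNeumannKnitRightRemainder
import Summits.QuantumFields.YangMills.Theorems.BalabanUVNodesN15TwoSpacingGluingAveragingDefect
import HarnessLib

/-!
# THE GLUING STEP AT TWO LATTICE SPACINGS, LVIII: THE SOURCE-SIDE TWO-GRID DEFECT OF THE NONLOCAL PART BEHIND A CUT CUBE OF THE COVER —
# `𝔇((M_{χ′}G′(□))∘[N′_L, M_{h′}], (M_χG(□))∘[N_L, M_h])`, HYPOTHESIS-FREE (dag-n15-c g14, FILE 100; N15 = NE2, s1 «background-layer OPERATOR ingredient»)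

Cell `pub-ymgap`, seat `pub-ymgap-dag-n15-c` (R134 (a); HUMAN RULING D-0062), generation 14.  `bears_on: R4∕N15 · K3⁸ SpineGivenEndpointR13SepCoPHV (stmt-QuantumFields-27366)`.
Filed `--supports stmt-QuantumFields-27366 --as helper` — COUNT-NEUTRAL.  Theorems only (0 `def`, 0 `sorry`).  Imports BY NAME FILE 95 `…NeumannKnitRightRemainder` (`maj₀_weaken` ∕ `maj₂_weaken`; through it FILE 94 and FILES 45–91: `idef` calculus,
FILE 56 `hasMaj_commOp_nonlocal` ∕ `hasMaj_idef_commOp_nonlocal`, FILE 57 `hasMaj_comp_exp_out`, FILE 67 `coverHb` ∕ `abs_coverHb_sub_le` ∕ `abs_coverH_sub_coverHb_le` ∕ `abs_coverH_fine_sub_le`,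
FILE 69 `hasMaj_nonlocalPart`, FILE 70 `knitG` ∕ `knitH` ∕ `coverMargin` ∕ `MP_succ_eq`, dag-n15-a `ineq110_114_pair` ∕ `hasMaj_gOp_of_ineq` ∕ `hasMaj_landauRe` ∕
N-IIc `hasMaj_idef_chiCube_neumannCubeG` ∕ `hasMaj_chiCube_symOp_comp` ∕ `hasMaj_comp_mulOp_chiInt`) and FILE 99 `…TwoSpacingGluingAveragingDefect` (★★ `hasMaj_idef_nonlocal_family`: the
OPERATOR letter `𝔇(N′_L, N_L)` on rough inputs); nothing in the tree is modified.

WHY.  FILE 97 `hasMaj_idef_chiCube_neumannCubeG_comp_commOp_deltaOp` proved the two-grid defect of one cube's adjoint remainder row with its LOCAL part from the sandwiched right entries and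
DISPLAYED the nonlocal part `𝔇((M_{χ′}G′(□))∘[N′_L, M_{h′}], (M_χG(□))∘[N_L, M_h])`, `N_L = aQ*Q − ∂Π∂*` (its hypothesis `hDN`; FILE 98's binder `hDN`; my WANT-n15-a g13-2 (β)).  By Leibniz
(`idef_comp`) it is `(M_{χ′}G′(□))∘𝔇([N′_L, M_{h′}], [N_L, M_h]) + 𝔇(M_{χ′}G′(□), M_χG(□))∘[N_L, M_h]`: the first defect is my g11 FILE 56 `hasMaj_idef_commOp_nonlocal` fed with FILE 99's
operator letter and FILE 67's Lipschitz ∕ oscillation ∕ fit moduli of the cover's partition, the second is dag-n15-a's N-IIc times FILE 56's commutator letter; both keep the output indicator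
through FILE 57 `hasMaj_comp_exp_out`.

WHAT.  §1 `blockOf_fine_eq`, ★ `coverHb_eq_of_spacing` (the block representative `h̄_k` does not depend on the spacing), `nonlocalConst_le`.  §2 ★★★ `hasMaj_idef_chiCube_neumannCubeG_comp_commOp_nonlocal_of`
— per cube, on `M_ν = 2qw`, letters as hypotheses at ONE rate `δ₀` (fine torus letter of `G′` (`C`), the `∂Π∂*` letters at both spacings (`C₁`), N-IIc's two-sided cut defect (`m_G`), the operator
letter `𝔇(N′_L, N_L) ≤ r_N e^{−δ₀d}`):
  `𝔇((M_{χ′}G′(□))∘[N′_L, M_{h′}], (M_χG(□))∘[N_L, M_h]) ≤ 1_□(y)·(β((ℓE + 2ℓ)r_N + 2oc_N) + m_G(ℓE + 2ℓ)c_N)·c_r·e^{−(δ₀∕2)d}`,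
`β = 2^{d+1}Ce^{δ₀}`, `c_N = |a|e^{2δ₀} + C₁`, `ℓ = π(d+1)∕w` (Lipschitz AND oscillation modulus), `E = (e·δ₀∕4)⁻¹`, `o = π(d+1)∕(L^kw)`, `c_r = latticeConst_{d+1}(δ₀∕4)`.  §3 ★★★
**`hasMaj_idef_chiCube_neumannCubeG_comp_commOp_nonlocal`** — THE `hDN` ROW OF FILE 98 LITERALLY, hypothesis-free on the doubled torus `MP (paramsOf d L (m+1) k hL)` with the cover's cubes
(`knitG`, `knitH`): for odd `L ≥ 3`, `a > 0` there are `δ_N, γ_N > 0`, `r_N ≥ 0` with, for all `m`, `k ≥ 1` (`4 ≤ L^k`), `r`, `k_□`,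
  `𝔇 ≤ 1_{□}(y)·r_N·(L^k)^{−γ_N}·e^{−δ_N|y−y′|_T}`  (`γ_N = 1∕16`: N-IIc at King's rate `γ = 1∕8`, FILE 99 at `γ = 1∕8`, the fit's `(L^kL^m)⁻¹`).
CONSUMER: FILE 98 of record (`hasMaj_idef_remainderL_knit`, now hypothesis-free with dag-n15-a N-IIr for `hSrc`) and the cover's `NE2PlusOperator` socket (FILE 96 ∘ FILE 98).

HONEST FRAMING ∕ LIMITS.  Block-majorant bookkeeping over LANDED rows; constants crude and ours; `U ≡ 1` doubled-cube torus MODEL (cube = half torus: circular as an estimate); nothing of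
[B5]∕[B6]∕[B9] asserted ([B9] Thm 3.14 = difference TEMPLATE).  NE2⁺ NOT PRINTED, NOT proved; N15 NOT discharged; counts of record UNMOVED (typed 28∕28 · discharged 5∕27); one finite 𝕋⁴ at
fixed ε per index — NOT infinite volume, NOT OS on ℝ⁴, NOT a mass gap, NOT Clay; R4 closes `BalabanLadder.UV` only.  Restate-immune (no Theses import).
-/

noncomputable section

namespace Summit.QuantumFields.YangMills.BalabanUVNodes.N15.Gluing

open Literature.MathematicalPhysics.QuantumFieldTheory.Balaban1983to89
open Literature.MathematicalPhysics.QuantumFieldTheory.Balaban1983to89.B5Prop11Plancherel (Tor fine unitVec)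
open Literature.MathematicalPhysics.QuantumFieldTheory.Balaban1983to89.B11SectG (BlockNorm HasMaj hasMaj_zero)
open Literature.MathematicalPhysics.QuantumFieldTheory.Balaban1983to89.B6Prop26Gluing (mulOp ind ind_nonneg ind_le_one)
open Literature.MathematicalPhysics.QuantumFieldTheory.Balaban1983to89.T4EtaRateDefect (idef idef_comp idef_add idef_sub idef_zero)
open Literature.MathematicalPhysics.QuantumFieldTheory.Balaban1983to89.T4EtaRateCoeffDefect (pull diagK hasMaj_mulOp hasMaj_idef_mulOp)
open Literature.MathematicalPhysics.QuantumFieldTheory.Balaban1983to89.B6UnitTorusCarrier (unitTorusGeo triangle254_unitTorusGeo rowSum_unitTorusGeo unitTorusGeo_dist_nonneg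
  unitTorusGeo_dist_symm unitTorusGeo_dist_self)
open Literature.MathematicalPhysics.QuantumFieldTheory.Balaban1983to89.B5SiteBridgeP12 (MP)
open Literature.MathematicalPhysics.QuantumFieldTheory.King1986.Torus (blockOf tdistT tdistT_nonneg)
open Summit.QuantumFields.YangMills.BalabanUVNodes.N15.VectorPiece (bshiftEquiv kingPrV blkFine blkFine_apply)
open Summit.QuantumFields.YangMills.BalabanUVNodes.N15.TwoGrid (paramsOf deltaOp gOp neumannCubeG symOp symbOp sD sTinv chiCube cubeBlocks landauRe qvRe qvAdjRe
  ineq110_114_pair hasMaj_gOp_of_ineq hasMaj_landauRe hasMaj_chiCube_symOp_comp hasMaj_comp_mulOp_chiInt hasMaj_idef_chiCube_neumannCubeG)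

variable {d : ℕ}

/-! ## §1 Small bridges: nested blocks, the spacing-free block representative, the constant -/

section Bridges

open Real

variable {M : Fin (d + 1) → ℕ} [∀ μ, NeZero (M μ)] {L w q : ℕ} [NeZero L]

/-- King's nesting: the unit block of a fine bond is the unit block of its paired coarse bond (`blkFine_comp_kingPrV`). [cite: King1986, p.664 (pairing convention «x′ ∈ B^n(x)»)] -/
theorem blockOf_fine_eq (kk r : ℕ) (x' : Tor (fine (L ^ r * L ^ kk) M) × Fin (d + 1)) :
    blockOf (L ^ r * L ^ kk) M x'.1 = blockOf (L ^ kk) M (kingPrV L kk r M x').1 := by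
  have h := congrFun (VectorPiece.blkFine_comp_kingPrV (M := M) L kk r) x'
  rw [Function.comp_apply, blkFine_apply] at h
  exact h.symm

/-- ★ **THE BLOCK REPRESENTATIVE `h̄_k(y) = h_k(n·y, 0)` DOES NOT DEPEND ON THE SPACING `n`** (`coverXi_up`: `ξ_ν(n·y) = y_ν∕w`). [folklore] -/
theorem coverHb_eq_of_spacing (n n' : ℕ) [NeZero n] [NeZero n'] (hw : 0 < w) (k : Fin (d + 1) → ZMod (2 * q)) (y : Tor M) :
    coverHb M n' w q k y = coverHb M n w q k y := by
  unfold coverHb hcube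
  exact Finset.prod_congr rfl fun ν _ => by rw [coverXi_up hw, coverXi_up hw]

omit [∀ μ, NeZero (M μ)] [NeZero L] in
/-- The per-cube constant is `≤ R·θ` as soon as the three rate carriers are: `r_N = r₂θ`, `m_G = m_cθ`, `o ≤ ℓ₀θ`, and `ℓ ≤ ℓ₀`. [folklore] -/
theorem nonlocalConst_le {β E cN cr mc r₂ ℓ ℓ₀ o rN mG θ : ℝ} (hβ : 0 ≤ β) (hE : 0 ≤ E) (hcN : 0 ≤ cN) (hcr : 0 ≤ cr) (hmc : 0 ≤ mc) (hr₂ : 0 ≤ r₂) (hℓ0 : 0 ≤ ℓ)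
    (hℓ : ℓ ≤ ℓ₀) (hθ : 0 ≤ θ) (ho : o ≤ ℓ₀ * θ) (hrN : rN = r₂ * θ) (hmG : mG = mc * θ) :
    (β * ((ℓ * E + 2 * ℓ) * rN + 2 * o * cN) + mG * ((ℓ * E + 2 * ℓ) * cN)) * cr ≤
      ((β * ((ℓ₀ * E + 2 * ℓ₀) * r₂ + 2 * ℓ₀ * cN) + mc * ((ℓ₀ * E + 2 * ℓ₀) * cN)) * cr) * θ := by
  subst hrN hmG
  have hΛ : ℓ * E + 2 * ℓ ≤ ℓ₀ * E + 2 * ℓ₀ := by nlinarith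
  have hΛ0 : 0 ≤ ℓ * E + 2 * ℓ := by positivity
  have t1 : (ℓ * E + 2 * ℓ) * (r₂ * θ) ≤ (ℓ₀ * E + 2 * ℓ₀) * r₂ * θ := by
    rw [← mul_assoc]; exact mul_le_mul_of_nonneg_right (mul_le_mul_of_nonneg_right hΛ hr₂) hθ
  have t2 : 2 * o * cN ≤ 2 * ℓ₀ * cN * θ := by nlinarith [mul_le_mul_of_nonneg_right ho hcN]
  have t3 : mc * θ * ((ℓ * E + 2 * ℓ) * cN) ≤ mc * ((ℓ₀ * E + 2 * ℓ₀) * cN) * θ := by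
    have := mul_le_mul_of_nonneg_right hΛ hcN
    nlinarith [mul_nonneg hmc hθ]
  have hsum : β * ((ℓ * E + 2 * ℓ) * (r₂ * θ) + 2 * o * cN) + mc * θ * ((ℓ * E + 2 * ℓ) * cN) ≤
      (β * ((ℓ₀ * E + 2 * ℓ₀) * r₂ + 2 * ℓ₀ * cN) + mc * ((ℓ₀ * E + 2 * ℓ₀) * cN)) * θ := by
    nlinarith [mul_le_mul_of_nonneg_left (add_le_add t1 t2) hβ]
  calc _ ≤ (β * ((ℓ₀ * E + 2 * ℓ₀) * r₂ + 2 * ℓ₀ * cN) + mc * ((ℓ₀ * E + 2 * ℓ₀) * cN)) * θ * cr := mul_le_mul_of_nonneg_right hsum hcr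
    _ = _ := by ring

end Bridges

/-! ## §2 The source-side nonlocal defect of ONE cut cube, letters as hypotheses -/

section Cube

open Real

variable {M : Fin (d + 1) → ℕ} [∀ μ, NeZero (M μ)] {L kk r w q m₀ : ℕ} [NeZero L]

/-- ★★★ **THE SOURCE-SIDE TWO-GRID DEFECT OF THE NONLOCAL PART BEHIND ONE CUT CUBE, from letters.**  On `M_ν = 2qw`, cube `□_k` (side `qw`), coarse spacing `L^{−k}`, fine `L^{−(k+r)}` (King's
pairing `π`, `P = pull π`), with `N_L = a•Q*Q − ∂Π∂*`, `h = h_k` the cover's partition function at each spacing: from the fine torus letter `G′ ≤ Ce^{−δ₀d}`, the Landau letters `∂Π∂* ≤ C₁e^{−δ₀d}`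
(both spacings), N-IIc's two-sided cut defect `𝔇(M_{χ′}G′(□), M_χG(□)) ≤ 1_□1_□m_Ge^{−δ₀d}` and the OPERATOR letter `𝔇(N′_L, N_L) ≤ r_Ne^{−δ₀d}` (FILE 99):
  `𝔇((M_{χ′}G′(□))∘[N′_L, M_{h′}], (M_χG(□))∘[N_L, M_h]) ≤ 1_□(y)·(β((ℓE + 2ℓ)r_N + 2oc_N) + m_G(ℓE + 2ℓ)c_N)·c_r·e^{−(δ₀∕2)|y−y′|_T}`,
`β = 2^{d+1}Ce^{δ₀}`, `c_N = |a|e^{δ₀}e^{δ₀} + C₁`, `ℓ = π(d+1)∕w`, `E = (e·δ₀∕4)⁻¹`, `o = π(d+1)∕(L^kw)`, `c_r = latticeConst_{d+1}(δ₀∕4)` — Leibniz: `(M_{χ′}G′(□))∘𝔇([N′,M_{h′}],[N,M_h])` (FILE 56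
`hasMaj_idef_commOp_nonlocal` with FILE 67's moduli) `+ 𝔇(M_{χ′}G′(□), M_χG(□))∘[N, M_h]` (N-IIc × FILE 56 `hasMaj_commOp_nonlocal`), both through FILE 57 `hasMaj_comp_exp_out`.
[cite: Balaban1984PropagatorsI, (1.120)–(1.121) p.37, (1.126)–(1.128) p.38 (P(dh) = [∂P∂*, h]: shape + mechanism); Balaban1984PropagatorsII, (2.133)–(2.135) p.247 (shapes, transposed);
Balaban1985BackgroundPropagators, Thm 3.14 pp.426–427 (difference template)] -/
theorem hasMaj_idef_chiCube_neumannCubeG_comp_commOp_nonlocal_of (hM : ∀ ν, M ν = 2 * q * w) (hw : 0 < w) (k : Fin (d + 1) → ZMod (2 * q))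
    {a C δ₀ C₁ mG rN : ℝ} (hC : 0 < C) (hδ₀ : 0 < δ₀) (hC₁ : 0 ≤ C₁) (hmG : 0 ≤ mG) (hrN : 0 ≤ rN)
    (hG' : HasMaj (BlockNorm.ofBlocks (unitTorusGeo L kk M) (fun x : Tor (fine (L ^ r * L ^ kk) M) × Fin (d + 1) => blockOf (L ^ r * L ^ kk) M x.1))
      (BlockNorm.ofBlocks (unitTorusGeo L kk M) (fun x : Tor (fine (L ^ r * L ^ kk) M) × Fin (d + 1) => blockOf (L ^ r * L ^ kk) M x.1)) (gOp M (L ^ r * L ^ kk) a)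
      (fun y y' => C * Real.exp (-(δ₀ * tdistT M y y'))))
    (hNL : HasMaj (BlockNorm.ofBlocks (unitTorusGeo L kk M) (fun b : Tor (fine (L ^ kk) M) × Fin (d + 1) => blockOf (L ^ kk) M b.1))
      (BlockNorm.ofBlocks (unitTorusGeo L kk M) (fun b : Tor (fine (L ^ kk) M) × Fin (d + 1) => blockOf (L ^ kk) M b.1)) (landauRe M (L ^ kk))
      (fun y y' => C₁ * Real.exp (-(δ₀ * tdistT M y y'))))
    (hNL' : HasMaj (BlockNorm.ofBlocks (unitTorusGeo L kk M) (fun x : Tor (fine (L ^ r * L ^ kk) M) × Fin (d + 1) => blockOf (L ^ r * L ^ kk) M x.1))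
      (BlockNorm.ofBlocks (unitTorusGeo L kk M) (fun x : Tor (fine (L ^ r * L ^ kk) M) × Fin (d + 1) => blockOf (L ^ r * L ^ kk) M x.1)) (landauRe M (L ^ r * L ^ kk))
      (fun y y' => C₁ * Real.exp (-(δ₀ * tdistT M y y'))))
    (hIG : HasMaj (BlockNorm.ofBlocks (unitTorusGeo L kk M) (fun b : Tor (fine (L ^ kk) M) × Fin (d + 1) => blockOf (L ^ kk) M b.1))
      (BlockNorm.ofBlocks (unitTorusGeo L kk M) (fun x : Tor (fine (L ^ r * L ^ kk) M) × Fin (d + 1) => blockOf (L ^ r * L ^ kk) M x.1))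
      (idef (pull (kingPrV L kk r M)) (pull (kingPrV L kk r M))
        (mulOp (chiCube M (L ^ r * L ^ kk) (coverCorner M w q m₀ k) (q * w)) ∘ₗ neumannCubeG M (L ^ r * L ^ kk) (coverCorner M w q m₀ k) (q * w) a)
        (mulOp (chiCube M (L ^ kk) (coverCorner M w q m₀ k) (q * w)) ∘ₗ neumannCubeG M (L ^ kk) (coverCorner M w q m₀ k) (q * w) a))
      (fun y y' => ind ((cubeBlocks M (coverCorner M w q m₀ k) (q * w) : Finset _) : Set _) y * ind ((cubeBlocks M (coverCorner M w q m₀ k) (q * w) : Finset _) : Set _) y' *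
        (mG * Real.exp (-(δ₀ * tdistT M y y')))))
    (hDN : HasMaj (BlockNorm.ofBlocks (unitTorusGeo L kk M) (fun b : Tor (fine (L ^ kk) M) × Fin (d + 1) => blockOf (L ^ kk) M b.1))
      (BlockNorm.ofBlocks (unitTorusGeo L kk M) (fun x : Tor (fine (L ^ r * L ^ kk) M) × Fin (d + 1) => blockOf (L ^ r * L ^ kk) M x.1))
      (idef (pull (kingPrV L kk r M)) (pull (kingPrV L kk r M))
        (a • (qvAdjRe M (L ^ r * L ^ kk) ∘ₗ qvRe M (L ^ r * L ^ kk)) + (-landauRe M (L ^ r * L ^ kk))) (a • (qvAdjRe M (L ^ kk) ∘ₗ qvRe M (L ^ kk)) + (-landauRe M (L ^ kk))))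
      (fun y y' => rN * Real.exp (-(δ₀ * tdistT M y y')))) :
    HasMaj (BlockNorm.ofBlocks (unitTorusGeo L kk M) (fun b : Tor (fine (L ^ kk) M) × Fin (d + 1) => blockOf (L ^ kk) M b.1))
      (BlockNorm.ofBlocks (unitTorusGeo L kk M) (fun x : Tor (fine (L ^ r * L ^ kk) M) × Fin (d + 1) => blockOf (L ^ r * L ^ kk) M x.1))
      (idef (pull (kingPrV L kk r M)) (pull (kingPrV L kk r M))
        ((mulOp (chiCube M (L ^ r * L ^ kk) (coverCorner M w q m₀ k) (q * w)) ∘ₗ neumannCubeG M (L ^ r * L ^ kk) (coverCorner M w q m₀ k) (q * w) a) ∘ₗ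
          commOp (a • (qvAdjRe M (L ^ r * L ^ kk) ∘ₗ qvRe M (L ^ r * L ^ kk)) + (-landauRe M (L ^ r * L ^ kk))) (hcube (2 * q) (coverXi M (L ^ r * L ^ kk) w) k))
        ((mulOp (chiCube M (L ^ kk) (coverCorner M w q m₀ k) (q * w)) ∘ₗ neumannCubeG M (L ^ kk) (coverCorner M w q m₀ k) (q * w) a) ∘ₗ
          commOp (a • (qvAdjRe M (L ^ kk) ∘ₗ qvRe M (L ^ kk)) + (-landauRe M (L ^ kk))) (hcube (2 * q) (coverXi M (L ^ kk) w) k)))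
      (fun y y' => ind ((cubeBlocks M (coverCorner M w q m₀ k) (q * w) : Finset _) : Set _) y *
        (((2 ^ (d + 1) * (C * Real.exp δ₀) * ((π * (d + 1) / w * (Real.exp 1 * (δ₀ / 4))⁻¹ + 2 * (π * (d + 1) / w)) * rN +
              2 * (π * (d + 1) / (((L ^ kk : ℕ) : ℝ) * w)) * (|a| * (Real.exp δ₀ * Real.exp δ₀) + C₁)) +
            mG * ((π * (d + 1) / w * (Real.exp 1 * (δ₀ / 4))⁻¹ + 2 * (π * (d + 1) / w)) * (|a| * (Real.exp δ₀ * Real.exp δ₀) + C₁))) *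
            B4Sect5Proof.latticeConst (d + 1) (δ₀ / 4)) *
          Real.exp (-(δ₀ / 2 * tdistT M y y')))) := by
  have hn : 1 ≤ L ^ kk := Nat.one_le_pow _ _ (Nat.pos_of_ne_zero (NeZero.ne L))
  have hM' : ∀ ν, M ν = 2 * (q * w) := fun ν => by rw [hM ν, mul_assoc]
  have hwR : (0 : ℝ) < w := by exact_mod_cast hw
  have hβ : (0 : ℝ) ≤ 2 ^ (d + 1) * (C * Real.exp δ₀) := by positivity
  have hcN : 0 ≤ |a| * (Real.exp δ₀ * Real.exp δ₀) + C₁ := by positivity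
  have hℓ : (0 : ℝ) ≤ π * (d + 1) / w := by positivity
  have ho : (0 : ℝ) ≤ π * (d + 1) / (((L ^ kk : ℕ) : ℝ) * w) := by positivity
  have hε : (0 : ℝ) < δ₀ / 4 := by positivity
  have hcr : 0 ≤ B4Sect5Proof.latticeConst (d + 1) (δ₀ / 4) := B4Sect5Proof.latticeConst_nonneg (d + 1) hε.le
  -- the fine two-sided cut row (N-IIIb)
  have hGc' : HasMaj (BlockNorm.ofBlocks (unitTorusGeo L kk M) (fun x : Tor (fine (L ^ r * L ^ kk) M) × Fin (d + 1) => blockOf (L ^ r * L ^ kk) M x.1))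
      (BlockNorm.ofBlocks (unitTorusGeo L kk M) (fun x : Tor (fine (L ^ r * L ^ kk) M) × Fin (d + 1) => blockOf (L ^ r * L ^ kk) M x.1))
      (mulOp (chiCube M (L ^ r * L ^ kk) (coverCorner M w q m₀ k) (q * w)) ∘ₗ neumannCubeG M (L ^ r * L ^ kk) (coverCorner M w q m₀ k) (q * w) a)
      (fun y y' => ind ((cubeBlocks M (coverCorner M w q m₀ k) (q * w) : Finset _) : Set _) y * ind ((cubeBlocks M (coverCorner M w q m₀ k) (q * w) : Finset _) : Set _) y' *
        (2 ^ (d + 1) * (C * Real.exp δ₀) * Real.exp (-(δ₀ * tdistT M y y')))) :=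
    hasMaj_chiCube_symOp_comp (L := L) (k := kk) (c := coverCorner M w q m₀ k) (S := q * w) hC.le hδ₀.le hM'
      (hasMaj_comp_mulOp_chiInt (c := coverCorner M w q m₀ k) (S := q * w) hC.le hG')
  -- the letters of the nonlocal part at both spacings
  have hN := hasMaj_nonlocalPart (L := L) (kk := kk) (a := a) hC₁ hδ₀.le le_rfl hNL
  have hN' := hasMaj_nonlocalPart (L := L) (kk := kk) (a := a) hC₁ hδ₀.le le_rfl hNL'
  -- the partition's moduli (FILE 67)
  have hLip := fun y y' => abs_coverHb_sub_le (n := L ^ kk) hM hw k y y'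
  have hr := fun x => abs_coverH_sub_coverHb_le (n := L ^ kk) hM hw k x
  have hr' : ∀ x' : Tor (fine (L ^ r * L ^ kk) M) × Fin (d + 1),
      |hcube (2 * q) (coverXi M (L ^ r * L ^ kk) w) k x' - coverHb M (L ^ kk) w q k (blockOf (L ^ kk) M (kingPrV L kk r M x').1)| ≤ π * (d + 1) / w := fun x' => by
    have h1 := abs_coverH_sub_coverHb_le (n := L ^ r * L ^ kk) hM hw k x'
    rw [coverHb_eq_of_spacing (L ^ kk) (L ^ r * L ^ kk) hw, blockOf_fine_eq] at h1
    exact h1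
  have hfit := fun x' => abs_coverH_fine_sub_le (L := L) (kk := kk) (r := r) hM hw k x'
  -- King's pairing of fine blocks
  have hblk : (fun x : Tor (fine (L ^ r * L ^ kk) M) × Fin (d + 1) => blockOf (L ^ r * L ^ kk) M x.1) =
      (fun b : Tor (fine (L ^ kk) M) × Fin (d + 1) => blockOf (L ^ kk) M b.1) ∘ kingPrV L kk r M := (VectorPiece.blkFine_comp_kingPrV (M := M) L kk r).symm
  rw [hblk] at hGc' hN' hIG hDN ⊢
  -- the η-defect of `[N′, M_{h′}]` against `[N, M_h]` (FILE 56) and the commutator letter of `[N, M_h]`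
  have hDC := hasMaj_idef_commOp_nonlocal (g := unitTorusGeo L kk M) (fun b : Tor (fine (L ^ kk) M) × Fin (d + 1) => blockOf (L ^ kk) M b.1) (kingPrV L kk r M)
    (hb := coverHb M (L ^ kk) w q k) (h := hcube (2 * q) (coverXi M (L ^ kk) w) k) (h' := hcube (2 * q) (coverXi M (L ^ r * L ^ kk) w) k)
    hcN hrN hℓ hℓ ho hε (unitTorusGeo_dist_nonneg L kk M) (unitTorusGeo_dist_symm L kk M) hLip hr hr' hfit hN hN' hDN
  have hCN := hasMaj_commOp_nonlocal (g := unitTorusGeo L kk M) (fun b : Tor (fine (L ^ kk) M) × Fin (d + 1) => blockOf (L ^ kk) M b.1)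
    (hb := coverHb M (L ^ kk) w q k) (h := hcube (2 * q) (coverXi M (L ^ kk) w) k) hcN hℓ hℓ hε (unitTorusGeo_dist_nonneg L kk M) (unitTorusGeo_dist_symm L kk M) hLip hr hN
  -- both pieces keep the output indicator (FILE 57)
  have hrow := rowSum_unitTorusGeo (L := L) (k := kk) (M := M) (σ := δ₀ / 4) hε
  have hK2 : 0 ≤ ((π * (d + 1) / w * (Real.exp 1 * (δ₀ / 4))⁻¹ + 2 * (π * (d + 1) / w)) * rN + 2 * (π * (d + 1) / (((L ^ kk : ℕ) : ℝ) * w)) * (|a| * (Real.exp δ₀ * Real.exp δ₀) + C₁)) := by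
    positivity
  have hK3 : 0 ≤ (π * (d + 1) / w * (Real.exp 1 * (δ₀ / 4))⁻¹ + 2 * (π * (d + 1) / w)) * (|a| * (Real.exp δ₀ * Real.exp δ₀) + C₁) := by positivity
  have hT1 := hasMaj_comp_exp_out (g := unitTorusGeo L kk M) ((fun b : Tor (fine (L ^ kk) M) × Fin (d + 1) => blockOf (L ^ kk) M b.1) ∘ kingPrV L kk r M)
    (triangle254_unitTorusGeo L kk M) (unitTorusGeo_dist_nonneg L kk M) hrow hβ hK2 (by positivity : (0 : ℝ) ≤ δ₀ / 2) (by linarith : δ₀ / 2 ≤ δ₀ - δ₀ / 4)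
    (by linarith : δ₀ / 2 + δ₀ / 4 ≤ δ₀) hGc' hDC
  have hT2 := hasMaj_comp_exp_out (g := unitTorusGeo L kk M) (fun b : Tor (fine (L ^ kk) M) × Fin (d + 1) => blockOf (L ^ kk) M b.1)
    (triangle254_unitTorusGeo L kk M) (unitTorusGeo_dist_nonneg L kk M) hrow hmG hK3 (by positivity : (0 : ℝ) ≤ δ₀ / 2) (by linarith : δ₀ / 2 ≤ δ₀ - δ₀ / 4)
    (by linarith : δ₀ / 2 + δ₀ / 4 ≤ δ₀) hIG hCN
  -- Leibniz
  rw [idef_comp (pull (kingPrV L kk r M)) (pull (kingPrV L kk r M)) (pull (kingPrV L kk r M))]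
  refine (hT1.add hT2).mono fun y y' => le_of_eq ?_
  simp only [unitTorusGeo]
  ring

end Cube

/-! ## §3 ★★★ The `hDN` row of FILE 98, hypothesis-free on the doubled torus with the cover's cubes -/

section Family

open Real

variable {L : ℕ} [NeZero L]

/-- ★★★ **THE SOURCE-SIDE NONLOCAL DEFECT OF THE COVER's CUT CUBES, HYPOTHESIS-FREE** — the binder `hDN` of FILE 98 `hasMaj_idef_remainderL_knit` LITERALLY: for odd `L ≥ 3`, `a > 0` there are
`δ_N, γ_N > 0`, `r_N ≥ 0` such that for all `m`, `k ≥ 1` (`4 ≤ L^k`), refinements `r` and cubes `□_k` of the cover, on the doubled torus `MP (paramsOf d L (m+1) k hL)`,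
  `𝔇((M_{χ′}G′(□))∘[a•Q′*Q′ − ∂Π∂*′, M_{h′}], (M_χG(□))∘[a•Q*Q − ∂Π∂*, M_h]) ≤ 1_{□}(y)·r_N·(L^k)^{−γ_N}·e^{−δ_N|y−y′|_T}`
(`γ_N = 1∕16`) — §2 fed with dag-n15-a's `ineq110_114_pair` ∕ `hasMaj_gOp_of_ineq` (fine `G′`), `hasMaj_landauRe` (both spacings), N-IIc `hasMaj_idef_chiCube_neumannCubeG` (`γ = 1∕8`), FILE 99
`hasMaj_idef_nonlocal_family` (`γ = 1∕8`), all at one rate; `ℓ = ω = π(d+1)∕L^m ≤ π(d+1)`, `o ≤ π(d+1)(L^k)^{−1∕16}` (`nonlocalConst_le`).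
[cite: Balaban1984PropagatorsI, (1.120)–(1.121) p.37, (1.126)–(1.128) p.38 (shape + mechanism); Balaban1985BackgroundPropagators, Thm 3.14 pp.426–427 (difference template); King1986,
Prop. 3.9 (3.73) p.665 (η-rate shape)] -/
theorem hasMaj_idef_chiCube_neumannCubeG_comp_commOp_nonlocal (hL : Odd L ∧ 1 < L) {a : ℝ} (ha : 0 < a) :
    ∃ δN rN γN : ℝ, 0 < δN ∧ 0 ≤ rN ∧ 0 < γN ∧ ∀ (m kk r : ℕ) (_hk : 1 ≤ kk) (_hn4 : 4 ≤ L ^ kk) (k : Fin (d + 1) → ZMod (2 * L)),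
      HasMaj (BlockNorm.ofBlocks (unitTorusGeo L kk (MP (paramsOf d L (m + 1) kk hL)))
          (fun b : Tor (fine (L ^ kk) (MP (paramsOf d L (m + 1) kk hL))) × Fin (d + 1) => blockOf (L ^ kk) (MP (paramsOf d L (m + 1) kk hL)) b.1))
        (BlockNorm.ofBlocks (unitTorusGeo L kk (MP (paramsOf d L (m + 1) kk hL)))
          (fun x : Tor (fine (L ^ r * L ^ kk) (MP (paramsOf d L (m + 1) kk hL))) × Fin (d + 1) => blockOf (L ^ r * L ^ kk) (MP (paramsOf d L (m + 1) kk hL)) x.1))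
        (idef (pull (kingPrV L kk r (MP (paramsOf d L (m + 1) kk hL)))) (pull (kingPrV L kk r (MP (paramsOf d L (m + 1) kk hL))))
          ((mulOp (chiCube (MP (paramsOf d L (m + 1) kk hL)) (L ^ r * L ^ kk) (coverCorner (MP (paramsOf d L (m + 1) kk hL)) (L ^ m) L (coverMargin L m) k) (L * L ^ m)) ∘ₗ
              knitG d L m kk (L ^ r * L ^ kk) hL a k) ∘ₗ
            commOp (a • (qvAdjRe (MP (paramsOf d L (m + 1) kk hL)) (L ^ r * L ^ kk) ∘ₗ qvRe (MP (paramsOf d L (m + 1) kk hL)) (L ^ r * L ^ kk)) +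
              (-landauRe (MP (paramsOf d L (m + 1) kk hL)) (L ^ r * L ^ kk))) (knitH d L m kk (L ^ r * L ^ kk) hL k))
          ((mulOp (chiCube (MP (paramsOf d L (m + 1) kk hL)) (L ^ kk) (coverCorner (MP (paramsOf d L (m + 1) kk hL)) (L ^ m) L (coverMargin L m) k) (L * L ^ m)) ∘ₗ
              knitG d L m kk (L ^ kk) hL a k) ∘ₗ
            commOp (a • (qvAdjRe (MP (paramsOf d L (m + 1) kk hL)) (L ^ kk) ∘ₗ qvRe (MP (paramsOf d L (m + 1) kk hL)) (L ^ kk)) +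
              (-landauRe (MP (paramsOf d L (m + 1) kk hL)) (L ^ kk))) (knitH d L m kk (L ^ kk) hL k)))
        (fun y y' => ind ((cubeBlocks (MP (paramsOf d L (m + 1) kk hL)) (coverCorner (MP (paramsOf d L (m + 1) kk hL)) (L ^ m) L (coverMargin L m) k) (L * L ^ m) : Finset _) : Set _) y *
          (rN * ((L : ℝ) ^ kk) ^ (-γN) * Real.exp (-(δN * tdistT (MP (paramsOf d L (m + 1) kk hL)) y y')))) := by
  have hL3 : 3 ≤ L := by obtain ⟨⟨j, hj⟩, h1⟩ := hL; omega
  have hLpos : 0 < L := by omega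
  have hL1 : 1 ≤ L := hLpos
  have hLodd : Odd L := hL.1
  have hL2 : 2 ≤ L := hL.2
  -- dag-n15-a's letters and FILE 99's operator letter
  obtain ⟨δ₀, C, Cα, Cε, Cαε, hδ₀, hC, H⟩ := ineq110_114_pair (d := d) hL ha
  obtain ⟨δ₁, C₁, hδ₁, hC₁, HL⟩ := hasMaj_landauRe (d := d) (L := L)
  obtain ⟨δc, mc, hδc, hmc, HC⟩ := hasMaj_idef_chiCube_neumannCubeG (d := d) hLodd hL2 ha (γ := 1 / 8) (by norm_num) (by norm_num)
  obtain ⟨δ₂, r₂, hδ₂, hr₂, HN⟩ := hasMaj_idef_nonlocal_family (d := d) hLodd hL2 ha (γ := 1 / 8) (by norm_num) (by norm_num)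
  -- one rate
  obtain ⟨δx, hδx_def⟩ : ∃ δx : ℝ, δx = min (min δ₀ δ₁) (min δc δ₂) := ⟨_, rfl⟩
  have hδx : 0 < δx := hδx_def ▸ lt_min (lt_min hδ₀ hδ₁) (lt_min hδc hδ₂)
  have dδ0 : δx ≤ δ₀ := hδx_def ▸ (min_le_left _ _).trans (min_le_left _ _)
  have dδ1 : δx ≤ δ₁ := hδx_def ▸ (min_le_left _ _).trans (min_le_right _ _)
  have dδc : δx ≤ δc := hδx_def ▸ (min_le_right _ _).trans (min_le_left _ _)
  have dδ2 : δx ≤ δ₂ := hδx_def ▸ (min_le_right _ _).trans (min_le_right _ _)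
  have hcr : 0 ≤ B4Sect5Proof.latticeConst (d + 1) (δx / 4) := B4Sect5Proof.latticeConst_nonneg (d + 1) (by positivity)
  -- the uniform constant (`w = L^m ≥ 1`: `ℓ ≤ ℓ₀ = π(d+1)`)
  refine ⟨δx / 2, (2 ^ (d + 1) * (C * Real.exp δx) * ((π * (d + 1) * (Real.exp 1 * (δx / 4))⁻¹ + 2 * (π * (d + 1))) * r₂ + 2 * (π * (d + 1)) * (|a| * (Real.exp δx * Real.exp δx) + C₁)) +
      mc * ((π * (d + 1) * (Real.exp 1 * (δx / 4))⁻¹ + 2 * (π * (d + 1))) * (|a| * (Real.exp δx * Real.exp δx) + C₁))) * B4Sect5Proof.latticeConst (d + 1) (δx / 4),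
    1 / 8 / 2, by positivity, by positivity, by norm_num, fun m kk r hk hn4 k => ?_⟩
  -- the index's data
  have hM : ∀ ν, MP (paramsOf d L (m + 1) kk hL) ν = 2 * L * L ^ m := MP_succ_eq L m kk hL
  have hw : 0 < L ^ m := pow_pos hLpos m
  have hn : 1 ≤ L ^ kk := Nat.one_le_pow _ _ hLpos
  have hn' : 1 ≤ L ^ r * L ^ kk := Nat.one_le_iff_ne_zero.mpr (Nat.mul_ne_zero (pow_ne_zero r (NeZero.ne L)) (pow_ne_zero kk (NeZero.ne L)))
  have hSe : L ^ (m + 1) = L * L ^ m := by rw [pow_succ, mul_comm]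
  have hwR : (1 : ℝ) ≤ ((L ^ m : ℕ) : ℝ) := by exact_mod_cast hw
  have hnR : (1 : ℝ) ≤ ((L ^ kk : ℕ) : ℝ) := by exact_mod_cast hn
  have hx : (1 : ℝ) ≤ (L : ℝ) ^ kk := one_le_pow₀ (by exact_mod_cast hL1)
  have hxcast : ((L ^ kk : ℕ) : ℝ) = (L : ℝ) ^ kk := Nat.cast_pow L kk
  -- the rate factor `θ = (L^k)^{−1∕16}` and the carriers' domination
  have hθ0 : 0 ≤ ((L : ℝ) ^ kk) ^ (-(1 / 8 / 2 : ℝ)) := Real.rpow_nonneg (zero_le_one.trans hx) _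
  have he16 : ((L ^ kk : ℕ) : ℝ) ^ (-(1 / 8 / 2 : ℝ)) = ((L : ℝ) ^ kk) ^ (-(1 / 8 / 2 : ℝ)) := by rw [hxcast]
  have hℓ : π * (d + 1) / ((L ^ m : ℕ) : ℝ) ≤ π * (d + 1) := div_le_self (by positivity) hwR
  have ho : π * (d + 1) / (((L ^ kk : ℕ) : ℝ) * ((L ^ m : ℕ) : ℝ)) ≤ π * (d + 1) * ((L : ℝ) ^ kk) ^ (-(1 / 8 / 2 : ℝ)) := by
    rw [div_eq_mul_inv]
    refine mul_le_mul_of_nonneg_left ?_ (by positivity)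
    calc (((L ^ kk : ℕ) : ℝ) * ((L ^ m : ℕ) : ℝ))⁻¹ ≤ (((L ^ kk : ℕ) : ℝ))⁻¹ := by
          rw [mul_inv]; exact mul_le_of_le_one_right (by positivity) (inv_le_one_of_one_le₀ hwR)
      _ = ((L : ℝ) ^ kk) ^ (-(1 : ℝ)) := by rw [hxcast, Real.rpow_neg_one]
      _ ≤ ((L : ℝ) ^ kk) ^ (-(1 / 8 / 2 : ℝ)) := Real.rpow_le_rpow_of_exponent_le hx (by norm_num)
  -- the letters at this index, at the rate `δx`
  have hG' := (hasMaj_gOp_of_ineq (L := L) (k := kk) (MP (paramsOf d L (m + 1) kk hL)) (L ^ r * L ^ kk) a hn' (H (m + 1) kk r hk).2 hC.le).mono fun y y' =>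
    maj₀_weaken le_rfl hC.le dδ0 y y'
  have hNL := (HL kk (L ^ kk) (MP (paramsOf d L (m + 1) kk hL))).mono fun y y' => maj₀_weaken le_rfl hC₁.le dδ1 y y'
  have hNL' := (HL kk (L ^ r * L ^ kk) (MP (paramsOf d L (m + 1) kk hL))).mono fun y y' => maj₀_weaken le_rfl hC₁.le dδ1 y y'
  have hIG := by
    have h := HC (m + 1) kk r hk hL (coverCorner (MP (paramsOf d L (m + 1) kk hL)) (L ^ m) L (coverMargin L m) k)
    rw [hSe, he16] at h
    exact h.mono fun y y' => maj₂_weaken (le_refl (mc * ((L : ℝ) ^ kk) ^ (-(1 / 8 / 2 : ℝ)))) (mul_nonneg hmc.le hθ0) dδc y y'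
  have hDN := by
    have h := HN (m + 1) kk r hk hL
    rw [he16] at h
    exact h.mono fun y y' => maj₀_weaken (le_refl (r₂ * ((L : ℝ) ^ kk) ^ (-(1 / 8 / 2 : ℝ)))) (mul_nonneg hr₂.le hθ0) dδ2 y y'
  -- §2 per cube
  have hcube := hasMaj_idef_chiCube_neumannCubeG_comp_commOp_nonlocal_of (L := L) (kk := kk) (r := r) (q := L) (w := L ^ m) (m₀ := coverMargin L m) hM hw k hC hδx hC₁.le
    (mul_nonneg hmc.le hθ0) (mul_nonneg hr₂.le hθ0) hG' hNL hNL' hIG hDN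
  refine hcube.mono fun y y' => mul_le_mul_of_nonneg_left (mul_le_mul_of_nonneg_right ?_ (Real.exp_nonneg _)) (ind_nonneg _ _)
  exact nonlocalConst_le (by positivity) (by positivity) (by positivity) hcr hmc.le hr₂.le (by positivity) hℓ hθ0 ho rfl rfl

end Family

end Summit.QuantumFields.YangMills.BalabanUVNodes.N15.Gluing

end
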